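import Mathlib.Analysis.SpecialFunctions.ImproperIntegrals

/-!
# The Goldstone exchange is integrable on the below-scale slab, uniformly in the transverse mass
# (crux `SeededBrokenRegimeBoseFermiPinned` = stmt-HubbardSuperconductivity-14047, route AposterioriCapRg; supports, lead c4)

WHAT (P3a of the post-restatement line).  In the broken regime the transverse (Goldstone) pair
propagator is `V_⊥(ν, q, p) = 1 / (Kτ ν² + Kx (q² + p²) + a)` with stiffnesses `Kτ, Kx > 0` and a
transverse mass `a = a_h ≥ 0` proportional to the symmetry-breaking seed `h`.  On the below-scale slab
`{|ν| ≤ 2Λ₀, |q| ≤ cΛ₀, p ∈ ℝ}` (a `2+1`-dimensional region: two bounded directions, one unbounded)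
its integral is bounded by `C(Kτ, Kx, c) · Λ₀`, UNIFORMLY in `a ≥ 0`: the `1/k²` Goldstone pole is
integrable in `2+1` dimensions.  This `h`-uniformity is the mechanism that lets the broken-regime flow
be controlled down to `h → 0`.

PROOF.  Pure real analysis (Lebesgue/Bochner integrals w.r.t. `volume`).
1. The line integral is explicit: `∫ dp / (A + Kx p²) = π / (√A · √Kx)` for `A > 0`
   (`integral_inv_add_mul_sq`, by scaling `∫ dp/(1+p²) = π`).
2. AM–GM, `Kτ ν² + Kx q² ≥ 2 √Kτ √Kx |ν| |q|`, turns `π / √A` into a PRODUCT of one-dimensional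
   integrable singularities: `∫ dp V_⊥ ≤ M · |ν|^{-1/2} · |q|^{-1/2}` for `ν q ≠ 0`, with
   `M = π / (√Kx · √(2 √Kτ √Kx))` (`exists_integral_inv_le`); the mass `a ≥ 0` only helps.
3. `∫_{-R}^{R} dx / √|x| = 4 √R` (`integral_inv_sqrt_abs`) and interval integrability of `1/√|x|`
   (`intervalIntegrable_inv_sqrt_abs`); the two outer integrals are then bounded with
   `MeasureTheory.integral_mono_of_nonneg` (which needs integrability of the dominating function
   only — the exceptional lines `ν = 0`, `q = 0` are null), giving
   `16 M √(cΛ₀) √(2Λ₀) = (16 M √c √2) · Λ₀`.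

SOURCES: elementary calculus; folklore.  (Context: the Goldstone-mode power counting of the
symmetry-broken fermionic RG, cf. M. Salmhofer, Commun. Math. Phys. 194 (1998) 249–295 [`Salmhofer1998`].)
-/

set_option linter.dupNamespace false -- `Summit.<S>.<S>` doubles the summit name (tree convention)

namespace Summit.HubbardSuperconductivity.HubbardSuperconductivity.Theorems.AposterioriCapRgSeededBrokenRegimeBoseFermiPinned

open MeasureTheory Real Set

namespace GoldstoneSlab

/-! ### 1. The line integral of a Lorentzian -/

/-- The Lorentzian line integral: `∫ dp / (A + k p²) = π / (√A · √k)` for `A, k > 0`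
(scaling of `∫ dp / (1 + p²) = π`). [folklore] -/
theorem integral_inv_add_mul_sq {A k : ℝ} (hA : 0 < A) (hk : 0 < k) :
    ∫ p : ℝ, (A + k * p ^ 2)⁻¹ = π / (√A * √k) := by
  have hsA : √A ≠ 0 := (sqrt_pos.2 hA).ne'
  have hsk : √k ≠ 0 := (sqrt_pos.2 hk).ne'
  have hAA : √A * √A = A := mul_self_sqrt hA.le
  have key : ∀ p : ℝ, (A + k * p ^ 2)⁻¹ = A⁻¹ * (1 + (√k / √A * p) ^ 2)⁻¹ := by
    intro p
    rw [← mul_inv, mul_add, mul_one, mul_pow, div_pow, sq_sqrt hk.le, sq_sqrt hA.le, ← mul_assoc,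
      mul_div_cancel₀ _ hA.ne']
  have hscale : ∫ p : ℝ, (1 + (√k / √A * p) ^ 2)⁻¹ = |(√k / √A)⁻¹| • ∫ u : ℝ, (1 + u ^ 2)⁻¹ :=
    Measure.integral_comp_mul_left (fun u : ℝ => (1 + u ^ 2)⁻¹) _
  simp_rw [key, integral_const_mul]
  rw [hscale, integral_univ_inv_one_add_sq, smul_eq_mul, inv_div,
    abs_of_nonneg (div_nonneg (sqrt_nonneg _) (sqrt_nonneg _)),
    show A⁻¹ = (√A * √A)⁻¹ by rw [hAA]]
  field_simp

/-! ### 2. AM–GM: the line integral of the Goldstone exchange is a product of `1/√` singularities -/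

/-- AM–GM in the form `2 √Kτ √Kx |ν| |q| ≤ Kτ ν² + Kx q²`. [folklore] -/
theorem two_sqrt_mul_abs_le {Kτ Kx : ℝ} (hKτ : 0 ≤ Kτ) (hKx : 0 ≤ Kx) (ν q : ℝ) :
    2 * √Kτ * √Kx * (|ν| * |q|) ≤ Kτ * ν ^ 2 + Kx * q ^ 2 := by
  calc 2 * √Kτ * √Kx * (|ν| * |q|) = 2 * (√Kτ * |ν|) * (√Kx * |q|) := by ring
    _ ≤ (√Kτ * |ν|) ^ 2 + (√Kx * |q|) ^ 2 := two_mul_le_add_sq _ _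
    _ = Kτ * ν ^ 2 + Kx * q ^ 2 := by rw [mul_pow, mul_pow, sq_sqrt hKτ, sq_sqrt hKx, sq_abs, sq_abs]

/-- The line (`p`-) integral of the Goldstone exchange `1 / (Kτ ν² + Kx (q² + p²) + a)`, `a ≥ 0`, is
dominated by a product of one-dimensional integrable singularities: for `ν q ≠ 0` it is at most
`M / (√|ν| √|q|)` with `M = π / (√Kx √(2 √Kτ √Kx))` depending on the stiffnesses only. [folklore] -/
theorem exists_integral_inv_le {Kτ Kx : ℝ} (hKτ : 0 < Kτ) (hKx : 0 < Kx) :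
    ∃ M : ℝ, ∀ a : ℝ, 0 ≤ a → ∀ ν q : ℝ, ν ≠ 0 → q ≠ 0 →
      ∫ p : ℝ, (Kτ * ν ^ 2 + Kx * (q ^ 2 + p ^ 2) + a)⁻¹ ≤ M * (√|ν|)⁻¹ * (√|q|)⁻¹ := by
  refine ⟨π / (√Kx * √(2 * √Kτ * √Kx)), fun a ha ν q hν hq => ?_⟩
  have hν' : 0 < |ν| := abs_pos.2 hν
  have hq' : 0 < |q| := abs_pos.2 hq
  have hA : 0 < Kτ * ν ^ 2 + Kx * q ^ 2 + a := by positivity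
  have h1 : ∀ p : ℝ, Kτ * ν ^ 2 + Kx * (q ^ 2 + p ^ 2) + a =
      (Kτ * ν ^ 2 + Kx * q ^ 2 + a) + Kx * p ^ 2 := fun p => by ring
  simp_rw [h1]
  rw [integral_inv_add_mul_sq hA hKx]
  have hle : √(2 * √Kτ * √Kx) * √|ν| * √|q| ≤ √(Kτ * ν ^ 2 + Kx * q ^ 2 + a) := by
    rw [← sqrt_mul' _ hν'.le, ← sqrt_mul' _ hq'.le]
    refine sqrt_le_sqrt ?_
    have h := two_sqrt_mul_abs_le hKτ.le hKx.le ν q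
    linarith
  calc π / (√(Kτ * ν ^ 2 + Kx * q ^ 2 + a) * √Kx)
      ≤ π / (√(2 * √Kτ * √Kx) * √|ν| * √|q| * √Kx) :=
        div_le_div_of_nonneg_left pi_pos.le (by positivity) (by gcongr)
    _ = π / (√Kx * √(2 * √Kτ * √Kx)) * (√|ν|)⁻¹ * (√|q|)⁻¹ := by ring

/-! ### 3. The one-dimensional singular integral `∫ dx / √|x|` -/

/-- `x ↦ 1 / √|x|` is interval integrable on every interval: an integrable (`|x|^{-1/2}`) singularity
at the origin. [folklore] -/
theorem intervalIntegrable_inv_sqrt_abs (s t : ℝ) :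
    IntervalIntegrable (fun x : ℝ => (√|x|)⁻¹) volume s t := by
  have hpos : ∀ c : ℝ, 0 ≤ c → IntervalIntegrable (fun x : ℝ => (√|x|)⁻¹) volume 0 c := by
    intro c hc
    refine (intervalIntegrable_congr_ae ?_).1
      (intervalIntegral.intervalIntegrable_rpow' (a := 0) (b := c) (r := -(1 / 2 : ℝ)) (by norm_num))
    refine (ae_restrict_mem measurableSet_uIoc).mono fun x hx => ?_
    rw [uIoc_of_le hc] at hx
    show x ^ (-(1 / 2 : ℝ)) = (√|x|)⁻¹
    rw [abs_of_pos hx.1, sqrt_eq_rpow, rpow_neg hx.1.le]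
  have hall : ∀ c : ℝ, IntervalIntegrable (fun x : ℝ => (√|x|)⁻¹) volume 0 c := by
    intro c
    rcases le_total 0 c with hc | hc
    · exact hpos c hc
    · have h := (IntervalIntegrable.iff_comp_neg (f := fun x : ℝ => (√|x|)⁻¹) (a := 0) (b := -c)).1
        (hpos (-c) (neg_nonneg.2 hc))
      simpa only [abs_neg, neg_zero, neg_neg] using h
  exact (hall s).symm.trans (hall t)

/-- `x ↦ 1 / √|x|` is integrable on every compact interval. [folklore] -/
theorem integrableOn_inv_sqrt_abs (s t : ℝ) :
    IntegrableOn (fun x : ℝ => (√|x|)⁻¹) (Set.Icc s t) := by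
  rcases le_or_gt s t with hst | hst
  · exact (intervalIntegrable_iff_integrableOn_Icc_of_le hst).1 (intervalIntegrable_inv_sqrt_abs s t)
  · rw [Icc_eq_empty_of_lt hst]
    exact integrableOn_empty

/-- `∫_{-R}^{R} dx / √|x| = 4 √R` for `R ≥ 0`. [folklore] -/
theorem integral_inv_sqrt_abs {R : ℝ} (hR : 0 ≤ R) :
    ∫ x in Set.Icc (-R) R, (√|x|)⁻¹ = 4 * √R := by
  have h0R : ∫ x in (0 : ℝ)..R, (√|x|)⁻¹ = 2 * √R := by
    have heq : EqOn (fun x : ℝ => (√|x|)⁻¹) (fun x => x ^ (-(1 / 2 : ℝ))) (uIcc 0 R) := by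
      intro x hx
      rw [uIcc_of_le hR] at hx
      show (√|x|)⁻¹ = x ^ (-(1 / 2 : ℝ))
      rw [abs_of_nonneg hx.1, sqrt_eq_rpow, rpow_neg hx.1]
    have e1 : (-(1 / 2 : ℝ) + 1) = 1 / 2 := by norm_num
    rw [intervalIntegral.integral_congr heq, integral_rpow (r := -(1 / 2 : ℝ)) (Or.inl (by norm_num)), e1,
      zero_rpow (show (1 / 2 : ℝ) ≠ 0 by norm_num), sub_zero, ← sqrt_eq_rpow]
    ring
  have hR0 : ∫ x in (-R)..0, (√|x|)⁻¹ = 2 * √R := by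
    rw [← h0R]
    have h := intervalIntegral.integral_comp_neg (a := 0) (b := R) (f := fun x : ℝ => (√|x|)⁻¹)
    simp only [abs_neg, neg_zero] at h
    exact h.symm
  rw [integral_Icc_eq_integral_Ioc, ← intervalIntegral.integral_of_le (by linarith),
    ← intervalIntegral.integral_add_adjacent_intervals (intervalIntegrable_inv_sqrt_abs (-R) 0)
      (intervalIntegrable_inv_sqrt_abs 0 R), hR0, h0R]
  ring

end GoldstoneSlab

open GoldstoneSlab in
/-- **W6 (P3a, `GoldstoneSlab`)**: the Goldstone exchange `1 / (Kτ ν² + Kx (q² + p²) + a)` is integrable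
on the below-scale slab `{|ν| ≤ 2Λ₀, |q| ≤ cΛ₀, p ∈ ℝ}` in `2+1` dimensions, with the natural `Λ₀`
scaling and UNIFORMLY in the transverse mass `a ≥ 0`: the bound is `C · Λ₀` with
`C = 16 √2 √c · π / (√Kx √(2 √Kτ √Kx))` depending on `Kτ, Kx, c` only. [folklore] -/
theorem stub_goldstoneSlabIntegrable :
    ∀ (Kτ Kx c : ℝ), 0 < Kτ → 0 < Kx → 0 < c → ∃ C : ℝ, ∀ Λ₀ : ℝ, 0 < Λ₀ → ∀ a : ℝ, 0 ≤ a →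
      ∫ ν in Set.Icc (-(2 * Λ₀)) (2 * Λ₀), ∫ q in Set.Icc (-(c * Λ₀)) (c * Λ₀), ∫ p : ℝ,
          (Kτ * ν ^ 2 + Kx * (q ^ 2 + p ^ 2) + a)⁻¹ ≤ C * Λ₀ := by
  intro Kτ Kx c hKτ hKx hc
  obtain ⟨M, hM⟩ := exists_integral_inv_le hKτ hKx
  have hae : ∀ s : Set ℝ, ∀ᵐ x ∂(volume.restrict s), x ≠ (0 : ℝ) := fun s =>
    ae_restrict_of_ae (by simp [ae_iff])
  refine ⟨16 * M * √c * √2, fun Λ₀ hΛ₀ a ha => ?_⟩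
  have hΛ : √Λ₀ * √Λ₀ = Λ₀ := mul_self_sqrt hΛ₀.le
  -- Step 1: the `q`-integral at fixed `ν ≠ 0` is dominated by `∫ dq  M / (√|ν| √|q|)`.
  have hq : ∀ ν : ℝ, ν ≠ 0 →
      ∫ q in Set.Icc (-(c * Λ₀)) (c * Λ₀), ∫ p : ℝ, (Kτ * ν ^ 2 + Kx * (q ^ 2 + p ^ 2) + a)⁻¹ ≤
        M * (√|ν|)⁻¹ * (4 * √(c * Λ₀)) := by
    intro ν hν
    calc ∫ q in Set.Icc (-(c * Λ₀)) (c * Λ₀), ∫ p : ℝ, (Kτ * ν ^ 2 + Kx * (q ^ 2 + p ^ 2) + a)⁻¹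
        ≤ ∫ q in Set.Icc (-(c * Λ₀)) (c * Λ₀), M * (√|ν|)⁻¹ * (√|q|)⁻¹ := by
          refine integral_mono_of_nonneg (Filter.Eventually.of_forall fun q => ?_)
            ((integrableOn_inv_sqrt_abs _ _).const_mul _) ?_
          · exact integral_nonneg fun p => inv_nonneg.2 (by positivity)
          · filter_upwards [hae _] with q hq0
            exact hM a ha ν q hν hq0
      _ = M * (√|ν|)⁻¹ * ∫ q in Set.Icc (-(c * Λ₀)) (c * Λ₀), (√|q|)⁻¹ := integral_const_mul _ _
      _ = M * (√|ν|)⁻¹ * (4 * √(c * Λ₀)) := by rw [integral_inv_sqrt_abs (by positivity)]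
  -- Step 2: the `ν`-integral is dominated by `∫ dν  4 M √(cΛ₀) / √|ν|`.
  calc ∫ ν in Set.Icc (-(2 * Λ₀)) (2 * Λ₀), ∫ q in Set.Icc (-(c * Λ₀)) (c * Λ₀), ∫ p : ℝ,
          (Kτ * ν ^ 2 + Kx * (q ^ 2 + p ^ 2) + a)⁻¹
      ≤ ∫ ν in Set.Icc (-(2 * Λ₀)) (2 * Λ₀), M * (4 * √(c * Λ₀)) * (√|ν|)⁻¹ := by
        refine integral_mono_of_nonneg (Filter.Eventually.of_forall fun ν => ?_)
          ((integrableOn_inv_sqrt_abs _ _).const_mul _) ?_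
        · exact integral_nonneg fun q => integral_nonneg fun p => inv_nonneg.2 (by positivity)
        · filter_upwards [hae _] with ν hν0
          calc ∫ q in Set.Icc (-(c * Λ₀)) (c * Λ₀), ∫ p : ℝ, (Kτ * ν ^ 2 + Kx * (q ^ 2 + p ^ 2) + a)⁻¹
              ≤ M * (√|ν|)⁻¹ * (4 * √(c * Λ₀)) := hq ν hν0
            _ = M * (4 * √(c * Λ₀)) * (√|ν|)⁻¹ := by ring
    _ = M * (4 * √(c * Λ₀)) * ∫ ν in Set.Icc (-(2 * Λ₀)) (2 * Λ₀), (√|ν|)⁻¹ := integral_const_mul _ _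
    _ = M * (4 * √(c * Λ₀)) * (4 * √(2 * Λ₀)) := by rw [integral_inv_sqrt_abs (by positivity)]
    _ = 16 * M * √c * √2 * (√Λ₀ * √Λ₀) := by
        rw [sqrt_mul hc.le, sqrt_mul zero_le_two]
        ring
    _ = 16 * M * √c * √2 * Λ₀ := by rw [hΛ]

end Summit.HubbardSuperconductivity.HubbardSuperconductivity.Theorems.AposterioriCapRgSeededBrokenRegimeBoseFermiPinned
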